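import Summits.CriticalPhenomena.SAWScalingLimit.Theorems.SAWDevelopingMapHexTightArcTightOfPinch
import Literature.Probability.RandomPlanarGeometry.ShellTraversalNet
import HarnessLib

/-!
# Stub `stub_arcTightOfPinchDecay` of the line `reversal-virgin-disc` (crux `HexTight`, stmt-CriticalPhenomena-5423)

Landing target
`Summits/CriticalPhenomena/SAWScalingLimit/Theorems/SAWDevelopingMapHexTightArcTightOfPinchDecay.lean`
(skeleton r8). Objects (`IsHArc`, `arcCurve`, `arcMass`, `travMass`, `Straddles`, `IsVirgin`) from
`SAWDevelopingMapHexTightReversalDefs.lean`; the named hypothesis `TravLocalization` from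
`SAWDevelopingMapHexTightPinchDefs.lean`; the `arcMass` / `travMass` API (`arcTight_arcMass_nonneg`,
`arcTight_travMass_mono`, `arcTight_travMass_le_sum`, `arcTight_dist_netPoint`) from the r5 sibling
`SAWDevelopingMapHexTightArcTightOfPinch.lean`, of which this file is the r8 generalisation.
WHAT: CHORDAL TRAVERSAL TIGHTNESS FROM PINCH DECAY — traversal localization (`TravLocalization`) and
the r8 interior atom `PinchDecay` (for SOME threshold `k ≥ 1`, SOME nonnegative rate `φ` with
`φ(t) = o(t)` as `t → 0⁺` and SOME `N_p`: uniformly over configurations virgin at radius `N ≥ N_p`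
and rim doors, `travMass_k(D(z₀; η, N/2)) ≤ φ(η/N) · arcMass` for `1 ≤ η ≤ N/4`) imply the rate-free
chordal tightness `ArcTraversalTight`: at each aspect `A ≥ 4` and tolerance `η > 0` there is a
threshold `k₀` such that, uniformly over virgin configurations at radius `N ≥ N₀` and doors `w, w'`,
the arcs whose polyline traverses `D(z₀; N/A, N/2)` by `k₀` separate segments carry at most `η` of the
arc mass. HOW (plane geometry in the tree + bookkeeping; lattice units, `N = 16 M'`, net size `M`,
`e = π M' / M`): `k₀ = Σ_{j<M} k = M k` separate traversals of `D(z₀; N/A, N/2) ⊇ D(z₀; 6M', 8M')`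
localize, by Aizenman–Burchard net localization WITH THRESHOLDS
(`Curve.exists_net_hasTraversals_of_hasTraversals`), to `k` separate traversals of
`D(y_j; 14e, M' - 14e)` about one of the `M` net points `y_j = z₀ + 7M' e^{i(-π + 2πj/M)}` of the middle
circle (`arcTightDecay_cover`); so the traversal mass is at most the sum over `j < M` of the net-point
traversal masses (`arcTight_travMass_le_sum`); each of those is at most `φ(t₁) · arcMass`,
`t₁ = (14e + 2)/(M' + 2)`, by `TravLocalization` at `(y_j, r₁ = M' + 2)` fed with `PinchDecay` on the
sub-configurations (`arcTightDecay_netPoint`); and since `t₁ ≤ 200/M ≤ t₀` (`arcTightDecay_ratio_le`),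
where `φ(t) ≤ (η/400) t` on `(0, t₀]`, the union bound gives `M φ(t₁) ≤ M (η/400) (200/M) = η/2 ≤ η`
(`arcTightDecay_union_le`) — exactly the place where `φ(t) = o(t)` is the minimal hypothesis. Constants:
`M = ⌈2000 + 200/t₀⌉₊`, `N₀ = 16 max(N_p, M)`.
-/

noncomputable section

open scoped BigOperators Classical
open Literature.Probability.LatticeModels Literature.Probability.RandomPlanarGeometry
  Literature.Probability.RandomPlanarGeometry.SAW

namespace Summit.CriticalPhenomena.SAWScalingLimit.Theorems.HexTight.Reversal

/-! ## Plane geometry: the net cover of the middle circle, with thresholds -/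

/-- **Net cover with thresholds.** `Σ_{j<M} k` separate traversals of `D(z₀; 16M'/A, 8M')` (`A ≥ 4`,
so the shell contains `D(z₀; 6M', 8M')`) force `k` separate traversals of `D(y_j; 14e, M' - 14e)`,
`e = πM'/M`, about one of the `M ≥ 1` net points `y_j = z₀ + 7M' e^{i(-π + 2πj/M)}` of the middle
circle `|y - z₀| = 7M'` (`Curve.exists_net_hasTraversals_of_hasTraversals` on `D(z₀; 6M', 8M')`:
middle radius `7M'`, net mesh `2π · 7M'/M = 14e`, half-width `M'`). -/
theorem arcTightDecay_cover {γ : Curve ℂ} {z₀ : ℂ} {M' A : ℝ} {M k : ℕ} (hM' : 0 < M')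
    (hA : 4 ≤ A) (hM : 1 ≤ M)
    (h : γ.HasTraversals (∑ _j ∈ Finset.range M, k) z₀ (16 * M' / A) (16 * M' / 2)) :
    ∃ j < M, γ.HasTraversals k (z₀ + ((7 * M' : ℝ) : ℂ) *
        Complex.exp (((-Real.pi + 2 * Real.pi * j / M : ℝ) : ℂ) * Complex.I))
      (14 * (Real.pi * M' / M)) (M' - 14 * (Real.pi * M' / M)) := by
  have hA4 : 16 * M' / A ≤ 16 * M' / 4 :=
    div_le_div_of_nonneg_left (by positivity) (by norm_num) hA
  have h1 : γ.HasTraversals (∑ _j ∈ Finset.range M, k) z₀ (6 * M') (8 * M') :=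
    h.mono' (by linarith) (by linarith)
  obtain ⟨j, hj, h2⟩ := Curve.exists_net_hasTraversals_of_hasTraversals
    (by positivity : (0 : ℝ) ≤ 6 * M') (by linarith) hM (fun _ => k) h1
  have h7 : (6 * M' + 8 * M') / 2 = 7 * M' := by ring
  rw [h7] at h2
  refine ⟨j, hj, h2.mono' (le_of_eq ?_) (le_of_eq ?_)⟩
  · ring
  · ring

/-! ## One net point: localization + pinch decay -/

/-- **The charge of one net point.** In a virgin `16M'`-disc about `z₀` with doors `{u, c}`, `{u', c'}`
on the rim, for a centre `y` on the middle circle `|y - z₀| = 7M'` and `0 ≤ 500 e ≤ M'`, `M' ≥ 2000`,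
`M' ≥ N_p`: traversal localization at `(y, r₁ = M' + 2)` (the configuration is virgin there, both doors
are `≥ 9M'` away) reduces the `k`-traversal mass of `D(y; 14e, M' - 14e)` to the sub-configurations'
`k`-traversal masses of `D(y; 14e + 2, M' - 14e - 2) ⊆ D(y; 14e + 2, (M'+2)/2)`-events, which pinch
decay at radius `M' + 2`, inner radius `14e + 2 ∈ [1, (M'+2)/4]`, charges `φ((14e+2)/(M'+2))`. -/
theorem arcTightDecay_netPoint (hTL : TravLocalization) {k : ℕ} {φ : ℝ → ℝ} {Np : ℝ}
    (hk1 : 1 ≤ k) (hφ0 : ∀ t : ℝ, 0 ≤ φ t)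
    (hP : ∀ (H : SimpleGraph HexVertex) (Λ : Finset HexVertex) (z₀ : ℂ) (η N : ℝ)
      (w w' : Sym2 HexVertex), Np ≤ N → 1 ≤ η → η ≤ N / 4 →
      IsVirgin H Λ z₀ N → Straddles Λ z₀ N w → Straddles Λ z₀ N w' →
      travMass H Λ w w' k z₀ η (N / 2) ≤ φ (η / N) * arcMass H Λ w w')
    {H : SimpleGraph HexVertex} {Λ : Finset HexVertex} {z₀ y : ℂ} {M' e : ℝ}
    {u c u' c' : HexVertex} (hNp : Np ≤ M') (hM : 2000 ≤ M') (he0 : 0 ≤ e) (he : 500 * e ≤ M')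
    (hy : dist y z₀ = 7 * M') (hV : IsVirgin H Λ z₀ (16 * M')) (hu : u ∉ Λ) (hu' : u' ∉ Λ)
    (huc : hexGraph.Adj u c) (huc' : hexGraph.Adj u' c') (huN : 16 * M' < dist (hexCenter u) z₀)
    (huN' : 16 * M' < dist (hexCenter u') z₀) :
    travMass H Λ s(u, c) s(u', c') k y (14 * e) (M' - 14 * e) ≤
      φ ((14 * e + 2) / (M' + 2)) * arcMass H Λ s(u, c) s(u', c') := by
  -- both doors are far from `y`
  have hfar : ∀ v : HexVertex, 16 * M' < dist (hexCenter v) z₀ → M' + 2 < dist (hexCenter v) y := by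
    intro v hv
    have := dist_triangle (hexCenter v) y z₀
    linarith
  -- the configuration is virgin at `(y, M' + 2)`
  have hVy : IsVirgin H Λ y (M' + 2) := by
    refine ⟨fun v hv => hV.mem v ?_, fun v v' hv hv' hvv' => hV.adj v v' ?_ ?_ hvv'⟩
    · have := dist_triangle (hexCenter v) y z₀
      linarith
    · have := dist_triangle (hexCenter v) y z₀
      linarith
    · have := dist_triangle (hexCenter v') y z₀
      linarith
  refine hTL H Λ y (M' + 2) (14 * e) (M' - 14 * e) _ k u c u' c' hk1 (hφ0 _) (by linarith)
    (by linarith) (by linarith) hu hu' huc huc' (hfar u huN) (hfar u' huN') hVy ?_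
  intro Λ' m m' _ hV' hm hm'
  calc travMass H Λ' m m' k y (14 * e + 2) (M' - 14 * e - 2)
      ≤ travMass H Λ' m m' k y (14 * e + 2) ((M' + 2) / 2) :=
        arcTight_travMass_mono le_rfl (by linarith)
    _ ≤ φ ((14 * e + 2) / (M' + 2)) * arcMass H Λ' m m' :=
        hP H Λ' y (14 * e + 2) (M' + 2) m m' (by linarith) (by linarith) (by linarith) hV' hm hm'

/-! ## Real arithmetic of the union bound -/

/-- The pinch ratio at a net point is `≤ 200/M`: `(14e + 2)/(M' + 2) ≤ 200/M` for `e M = π M'`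
(`π ≤ 4`) and `0 < M ≤ M'`. -/
theorem arcTightDecay_ratio_le {e M' M : ℝ} (hM : 0 < M) (hMM' : M ≤ M')
    (heM : e * M = Real.pi * M') : (14 * e + 2) / (M' + 2) ≤ 200 / M := by
  have hM' : 0 < M' := lt_of_lt_of_le hM hMM'
  rw [div_le_div_iff₀ (by linarith) hM]
  have h1 : Real.pi * M' ≤ 4 * M' := mul_le_mul_of_nonneg_right Real.pi_le_four hM'.le
  have h2 : (14 * e + 2) * M = 14 * (e * M) + 2 * M := by ring
  rw [h2, heM]
  linarith

/-- The union bound constant: `M · φ(t₁) ≤ η / 2` once `φ(t₁) ≤ (η/400) t₁` and `0 ≤ t₁ ≤ 200/M`,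
`M > 0` — the one place where the rate `φ(t) = o(t)` (here: `φ ≤ (η/400) · id` near `0`) enters. -/
theorem arcTightDecay_union_le {φ : ℝ → ℝ} {η t₁ M : ℝ} (hη : 0 < η) (hM : 0 < M)
    (hφ : φ t₁ ≤ η / 400 * t₁) (ht : t₁ ≤ 200 / M) : M * φ t₁ ≤ η / 2 := by
  have h2 : t₁ * M ≤ 200 := by rwa [le_div_iff₀ hM] at ht
  calc M * φ t₁ ≤ M * (η / 400 * t₁) := mul_le_mul_of_nonneg_left hφ hM.le
    _ = η / 400 * (t₁ * M) := by ring
    _ ≤ η / 400 * 200 := mul_le_mul_of_nonneg_left h2 (by positivity)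
    _ = η / 2 := by ring

/-! ## The registered stub -/

/-- **stub D' — CHORDAL TIGHTNESS FROM PINCH DECAY** (`= TravLocalization → PinchDecay →
ArcTraversalTight`, skeleton r8): net localization with thresholds on the middle circle + union bound +
localization. With `PinchDecay`'s `(k, φ, N_p)` and `t₀ > 0` such that `φ(t) ≤ (η/400) t` on `(0, t₀]`:
net size `M = ⌈2000 + 200 / t₀⌉₊`, threshold `k₀ = Σ_{j<M} k`, `N₀ = 16 max(N_p, M)`; for
`N = 16M' ≥ N₀` the `k₀`-traversal mass of `D(z₀; N/A, N/2)` is at most `Σ_{j<M}` (`k`-traversal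
mass of `D(y_j; 14e, M' - 14e)` about the net point `y_j`, `e = πM'/M`)
`≤ M · φ((14e+2)/(M'+2)) · arcMass ≤ (η/2) · arcMass ≤ η · arcMass`. -/
theorem stub_arcTightOfPinchDecay :
    TravLocalization →
    (∃ (k : ℕ) (φ : ℝ → ℝ) (N₀ : ℝ), 1 ≤ k ∧ 0 < N₀ ∧ (∀ t : ℝ, 0 ≤ φ t) ∧
      (∀ ε : ℝ, 0 < ε → ∃ t₀ : ℝ, 0 < t₀ ∧ ∀ t : ℝ, 0 < t → t ≤ t₀ → φ t ≤ ε * t) ∧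
      ∀ (H : SimpleGraph HexVertex) (Λ : Finset HexVertex) (z₀ : ℂ) (η N : ℝ)
        (w w' : Sym2 HexVertex), N₀ ≤ N → 1 ≤ η → η ≤ N / 4 →
        IsVirgin H Λ z₀ N → Straddles Λ z₀ N w → Straddles Λ z₀ N w' →
        travMass H Λ w w' k z₀ η (N / 2) ≤ φ (η / N) * arcMass H Λ w w') →
    ∀ A : ℝ, 4 ≤ A → ∀ η : ℝ, 0 < η → ∃ (k₀ : ℕ) (N₀ : ℝ), 0 < N₀ ∧
      ∀ (H : SimpleGraph HexVertex) (Λ : Finset HexVertex) (z₀ : ℂ) (N : ℝ)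
        (w w' : Sym2 HexVertex), N₀ ≤ N →
        IsVirgin H Λ z₀ N → Straddles Λ z₀ N w → Straddles Λ z₀ N w' →
        travMass H Λ w w' k₀ z₀ (N / A) (N / 2) ≤ η * arcMass H Λ w w' := by
  intro hTL hP A hA η hη
  obtain ⟨k, φ, Np, hk1, hNp, hφ0, hφo, hPb⟩ := hP
  -- the rate: `φ t ≤ (η/400) t` on `(0, t₀]`
  obtain ⟨t₀, ht₀, hφt⟩ := hφo (η / 400) (by positivity)
  -- the net size `M`
  set M : ℕ := ⌈2000 + 200 / t₀⌉₊ with hM_def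
  have hMceil : (2000 : ℝ) + 200 / t₀ ≤ M := Nat.le_ceil _
  have hM2000 : (2000 : ℝ) ≤ M := by linarith [div_nonneg (by norm_num : (0 : ℝ) ≤ 200) ht₀.le]
  have hMpos : (0 : ℝ) < M := by linarith
  have hM1 : 1 ≤ M := by exact_mod_cast (show (1 : ℝ) ≤ M by linarith)
  have hMt : 200 / (M : ℝ) ≤ t₀ := by
    have h : 200 / t₀ ≤ M := by linarith
    rw [div_le_iff₀ ht₀] at h
    rw [div_le_iff₀ hMpos]
    linarith [mul_comm (M : ℝ) t₀]
  refine ⟨∑ _j ∈ Finset.range M, k, 16 * max Np (M : ℝ), by positivity, ?_⟩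
  intro H Λ z₀ N w w' hN hV hw hw'
  obtain ⟨M', rfl⟩ : ∃ M', N = 16 * M' := ⟨N / 16, by ring⟩
  have hmax : max Np (M : ℝ) ≤ M' := by linarith
  have hNpM' : Np ≤ M' := le_trans (le_max_left _ _) hmax
  have hMM' : (M : ℝ) ≤ M' := le_trans (le_max_right _ _) hmax
  have hM'2000 : 2000 ≤ M' := le_trans hM2000 hMM'
  have hM'0 : 0 < M' := by linarith
  obtain ⟨u, c, rfl, huc, hu, -, -, huN⟩ := hw
  obtain ⟨u', c', rfl, huc', hu', -, -, huN'⟩ := hw'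
  -- the small parameter `e = π M' / M`
  set e : ℝ := Real.pi * M' / M with he_def
  have he0 : 0 ≤ e := by positivity
  have heM : e * M = Real.pi * M' := div_mul_cancel₀ _ hMpos.ne'
  have he : 500 * e ≤ M' := by
    have h1 : Real.pi * M' ≤ 4 * M' := mul_le_mul_of_nonneg_right Real.pi_le_four hM'0.le
    have h2 : (2000 : ℝ) * M' ≤ M * M' := mul_le_mul_of_nonneg_right hM2000 hM'0.le
    have h3 : 500 * e * M ≤ M' * M := by nlinarith
    exact le_of_mul_le_mul_right h3 hMpos
  -- the charge of one net point: `φ t₁`, `t₁ = (14e+2)/(M'+2) ≤ 200/M ≤ t₀`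
  set t₁ : ℝ := (14 * e + 2) / (M' + 2) with ht₁_def
  have ht₁0 : 0 < t₁ := by positivity
  have ht₁M : t₁ ≤ 200 / M := arcTightDecay_ratio_le hMpos hMM' heM
  have hMφ : (M : ℝ) * φ t₁ ≤ η / 2 :=
    arcTightDecay_union_le hη hMpos (hφt t₁ ht₁0 (ht₁M.trans hMt)) ht₁M
  -- the net points
  set y : ℕ → ℂ := fun i => z₀ + ((7 * M' : ℝ) : ℂ) *
    Complex.exp (((-Real.pi + 2 * Real.pi * i / M : ℝ) : ℂ) * Complex.I) with hy_def
  have hyd : ∀ i, dist (y i) z₀ = 7 * M' := fun i => arcTight_dist_netPoint hM'0.le M i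
  calc travMass H Λ s(u, c) s(u', c') (∑ _j ∈ Finset.range M, k) z₀ (16 * M' / A) (16 * M' / 2)
      ≤ ∑ i ∈ Finset.range M, travMass H Λ s(u, c) s(u', c') k (y i) (14 * e) (M' - 14 * e) := by
        refine arcTight_travMass_le_sum fun γ hγ => ?_
        obtain ⟨i, hi, h⟩ := arcTightDecay_cover hM'0 hA hM1 hγ
        exact ⟨i, Finset.mem_range.2 hi, h⟩
    _ ≤ ∑ _i ∈ Finset.range M, φ t₁ * arcMass H Λ s(u, c) s(u', c') :=
        Finset.sum_le_sum fun i _ =>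
          arcTightDecay_netPoint hTL hk1 hφ0 hPb hNpM' hM'2000 he0 he (hyd i) hV hu hu' huc huc'
            huN huN'
    _ = (M : ℝ) * φ t₁ * arcMass H Λ s(u, c) s(u', c') := by
        rw [Finset.sum_const, Finset.card_range, nsmul_eq_mul]
        ring
    _ ≤ η * arcMass H Λ s(u, c) s(u', c') :=
        mul_le_mul_of_nonneg_right (by linarith) arcTight_arcMass_nonneg

end Summit.CriticalPhenomena.SAWScalingLimit.Theorems.HexTight.Reversal

end
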